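import Mathlib

/-!
# SEIL-F outer end: the Plemelj mass of the critical layer (solo-blind s85, kernel #191)

In the physical-angle picture (kernels #186, #188, #190) the frozen Doppler resolvent
`(2iPh cos θ + K₀∂²)⁻¹` is regularised across the critical layer `θ = π/2` as
`cos θ → cos θ - i0·sgn`, so that in the sense of angular moments the quasi-static streak
frame is `V_S = (hₓ/h) [p.v. 1/x + iπ δ(x)] + O(δ)`; numerically the inner Scorer profile
has `∫ Im Y dη = π` (paper §24.106 (4)).  The model computation behind the constant `π`
is the Lorentzian mass: for every width `ε > 0`,
`∫_{-L}^{L} ε/(η² + ε²) dη = 2 arctan(L/ε) → π` as `L → ∞` — the layer deposits the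
`P`-independent imaginary excess `iπ × (height × width)` whatever its width `ε ∝ P^{-1/3}`.
-/

namespace Summit.AnomalousDissipation.AnomalousDissipation.Theorems

open Real intervalIntegral Filter Topology

/-- The Lorentzian of width `ε` as a rescaled Cauchy kernel. -/
theorem lorentzian_eq {ε : ℝ} (hε : ε ≠ 0) (η : ℝ) :
    ε / (η ^ 2 + ε ^ 2) = ε⁻¹ * (1 + (η / ε) ^ 2)⁻¹ := by
  have h1 : η ^ 2 + ε ^ 2 ≠ 0 := by positivity
  field_simp
  ring

/-- Plemelj mass on a symmetric window: `∫_{-L}^{L} ε/(η²+ε²) dη = 2 arctan (L/ε)`. -/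
theorem plemelj_mass {ε : ℝ} (hε : 0 < ε) (L : ℝ) :
    ∫ η in (-L)..L, ε / (η ^ 2 + ε ^ 2) = 2 * arctan (L / ε) := by
  have hε0 : ε ≠ 0 := hε.ne'
  simp_rw [lorentzian_eq hε0]
  rw [intervalIntegral.integral_const_mul,
    intervalIntegral.integral_comp_div (fun u : ℝ => (1 + u ^ 2)⁻¹) hε0]
  simp only [smul_eq_mul]
  have : (∫ x : ℝ in (-L) / ε..L / ε, (1 + x ^ 2)⁻¹) = arctan (L / ε) - arctan (-L / ε) := by
    simp
  rw [this, neg_div, arctan_neg]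
  field_simp
  ring

/-- The mass is independent of the width in the limit: `2 arctan(L/ε) → π` as `L → ∞`. -/
theorem plemelj_mass_tendsto {ε : ℝ} (hε : 0 < ε) :
    Tendsto (fun L : ℝ => 2 * arctan (L / ε)) atTop (𝓝 π) := by
  have h1 : Tendsto (fun L : ℝ => L / ε) atTop atTop := tendsto_id.atTop_div_const hε
  have h2 : Tendsto arctan atTop (𝓝 (π / 2)) :=
    tendsto_nhds_of_tendsto_nhdsWithin tendsto_arctan_atTop
  have h3 := (h2.comp h1).const_mul 2
  have : (2 : ℝ) * (π / 2) = π := by ring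
  rw [this] at h3
  exact h3

/-- The mass is bounded by `π` on every window (so the layer excess never exceeds
`π × height × width`). -/
theorem plemelj_mass_lt_pi (ε L : ℝ) : 2 * arctan (L / ε) < π := by
  have := arctan_lt_pi_div_two (L / ε)
  linarith

end Summit.AnomalousDissipation.AnomalousDissipation.Theorems
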